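import Summits.NavierStokesRegularity.FunctionalMining.TopEigDanskin
import HarnessLib

/-!
# FunctionalMining — Danskin's formula along differentiable curves of tensors

Search for candidate a priori estimates; no regularity claim. Cell `pub-nsfunc`, prove seat
(gen 21). Companion to `TopEigDanskin.lean`: the one-sided derivative of the top Rayleigh value along
an arbitrary curve of tensors `t ↦ A(t)` that is right-differentiable at `t₀` with derivative `A'` is
`μ(A(t₀); A')` — the line case `A(t₀) + (t − t₀)A'` plus the `1`-Lipschitz bound
`|λ(A(t)) − λ(A(t₀) + (t − t₀)A')| ≤ ‖A(t) − A(t₀) − (t − t₀)A'‖ = o(t − t₀)`. This is the pointwise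
step of the exact ONE-SIDED production formula for the non-smooth cores `∫(λ₁⁺)^q`, `∫((−λ₃)⁺)^q`
along any smooth evolution of fields (Navier–Stokes, Euler, heat): `d⁺/dt λ₁(S(t,x))^q =
q λ₁^{q−1} μ(S; ∂ₜS)` wherever `λ₁ ≥ 0` along the curve.

* `TopEig.hasDerivWithinAt_lam_line_at` — the line lemma at a base point `t₀`;
* **`TopEig.hasDerivWithinAt_lam_comp`** — `HasDerivWithinAt A A' (Ioi t₀) t₀ →
  HasDerivWithinAt (λ ∘ A) (μ(A t₀; A')) (Ioi t₀) t₀`;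
* `TopEig.hasDerivWithinAt_lam_comp_rpow` — the same for `λ(A(t))^q`, `q ≥ 1`, when `λ ∘ A ≥ 0` on
  `[t₀, ∞)` (chain rule valid at base `0`).

[ours; folklore convex analysis]
-/

noncomputable section

open Filter Topology Set Asymptotics

namespace Summit.NavierStokesRegularity.FunctionalMining

namespace TopEig

variable {d : Type*} [Fintype d] [DecidableEq d] [Nonempty d]

/-- The line lemma at a base point: `t ↦ λ(A₀ + (t − t₀)M)` has right derivative `μ(A₀; M)` at `t₀`.
[folklore; Danskin] -/
theorem hasDerivWithinAt_lam_line_at (A₀ M : EuclideanSpace ℝ (d × d)) (t₀ : ℝ) :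
    HasDerivWithinAt (fun t : ℝ => lam (A₀ + (t - t₀) • M)) (dirTopEig A₀ M) (Set.Ioi t₀) t₀ := by
  have hline := hasDerivWithinAt_lam_line A₀ M
  have hφ : HasDerivWithinAt (fun t : ℝ => t - t₀) 1 (Set.Ioi t₀) t₀ := by
    simpa using (hasDerivWithinAt_id t₀ (Set.Ioi t₀)).sub_const t₀
  have hmaps : Set.MapsTo (fun t : ℝ => t - t₀) (Set.Ioi t₀) (Set.Ioi 0) := fun t ht => by
    simp only [Set.mem_Ioi] at ht ⊢; linarith
  have h := hline.scomp_of_eq t₀ (h := fun t : ℝ => t - t₀) hφ hmaps (by simp)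
  rw [one_smul] at h
  exact h

/-- **Danskin along a curve.** If `A : ℝ → ℝ^{d×d}` has right derivative `A'` at `t₀`, then
`t ↦ λ(A(t))` has right derivative `μ(A(t₀); A')` at `t₀`. [folklore; Danskin] -/
theorem hasDerivWithinAt_lam_comp {A : ℝ → EuclideanSpace ℝ (d × d)} {A' : EuclideanSpace ℝ (d × d)}
    {t₀ : ℝ} (hA : HasDerivWithinAt A A' (Set.Ioi t₀) t₀) :
    HasDerivWithinAt (fun t => lam (A t)) (dirTopEig (A t₀) A') (Set.Ioi t₀) t₀ := by
  have hline := hasDerivWithinAt_lam_line_at (A t₀) A' t₀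
  rw [hasDerivWithinAt_iff_isLittleO] at hA hline ⊢
  -- the Lipschitz comparison with the line
  have hcomp : (fun t => lam (A t) - lam (A t₀ + (t - t₀) • A')) =O[𝓝[Set.Ioi t₀] t₀]
      (fun t => A t - A t₀ - (t - t₀) • A') := by
    refine IsBigO.of_bound 1 (Eventually.of_forall fun t => ?_)
    rw [Real.norm_eq_abs, one_mul]
    have h := abs_lam_sub_lam_le (A t) (A t₀ + (t - t₀) • A')
    have e : A t - (A t₀ + (t - t₀) • A') = A t - A t₀ - (t - t₀) • A' := by abel
    rwa [e] at h
  have h1 := hcomp.trans_isLittleO hA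
  have h2 := h1.add hline
  refine h2.congr' (Eventually.of_forall fun t => ?_) (Eventually.of_forall fun _ => rfl)
  simp only [sub_self, zero_smul, add_zero, smul_eq_mul]
  ring

/-- **Danskin along a curve, `q`-th power.** If moreover `λ(A(t)) ≥ 0` for `t ≥ t₀` and `q ≥ 1`, then
`t ↦ λ(A(t))^q` has right derivative `q λ(A(t₀))^{q−1} μ(A(t₀); A')` at `t₀` (Mathlib's chain rule for
`r ↦ r^q` needs no `λ ≠ 0` when `q ≥ 1`; non-negativity is what makes `λ^q` the intended core
`(λ⁺)^q`). [folklore] -/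
theorem hasDerivWithinAt_lam_comp_rpow {A : ℝ → EuclideanSpace ℝ (d × d)} {A' : EuclideanSpace ℝ (d × d)}
    {t₀ : ℝ} (hA : HasDerivWithinAt A A' (Set.Ioi t₀) t₀) {q : ℝ} (hq : 1 ≤ q) :
    HasDerivWithinAt (fun t => lam (A t) ^ q) (q * lam (A t₀) ^ (q - 1) * dirTopEig (A t₀) A')
      (Set.Ioi t₀) t₀ := by
  have h := (hasDerivWithinAt_lam_comp hA).rpow_const (p := q) (Or.inr hq)
  exact h.congr_deriv (by ring)

/-- The positive-part form: if `λ(A(t)) ≥ 0` on `[t₀, ∞)`, then `t ↦ (λ(A(t))⁺)^q` has the same right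
derivative `q λ(A(t₀))^{q−1} μ(A(t₀); A')` at `t₀`. [folklore] -/
theorem hasDerivWithinAt_posPart_lam_comp_rpow {A : ℝ → EuclideanSpace ℝ (d × d)}
    {A' : EuclideanSpace ℝ (d × d)} {t₀ : ℝ} (hA : HasDerivWithinAt A A' (Set.Ioi t₀) t₀) {q : ℝ}
    (hq : 1 ≤ q) (hnn : ∀ t, t₀ ≤ t → 0 ≤ lam (A t)) :
    HasDerivWithinAt (fun t => max (lam (A t)) 0 ^ q)
      (q * lam (A t₀) ^ (q - 1) * dirTopEig (A t₀) A') (Set.Ioi t₀) t₀ := by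
  refine (hasDerivWithinAt_lam_comp_rpow hA hq).congr (fun t ht => ?_) ?_
  · rw [max_eq_left (hnn t (le_of_lt ht))]
  · rw [max_eq_left (hnn t₀ le_rfl)]

end TopEig

end Summit.NavierStokesRegularity.FunctionalMining

end
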